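import Literature.MathematicalPhysics.QuantumLattice.OverlapLocality
import HarnessLib

/-!
# Lüscher's magnetic-flux-sector fields on the periodic lattice and the finite-volume abelian index formula

Topic `Literature/MathematicalPhysics/QuantumLattice`; namespace `Literature.MathematicalPhysics.QuantumLattice`.

## The printed results

* [Luscher1999AbelianChiral] M. Lüscher, *Abelian chiral gauge theories on the lattice with exact gauge invariance*,
  Nucl. Phys. B 549 (1999) 295 (arXiv:hep-lat/9811032), §2.2 and §7.2.  Compact `U(1)` link fields `U(x,μ)` on the periodic
  lattice `Γ = {0,…,L−1}⁴`; field tensor `F_{μν}(x) = (1/i) ln` (plaquette) ∈ (−π, π]; the fields with `|F_{μν}(x)| < ε`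
  are *admissible* (§2.1 (2.9)); their magnetic flux `φ_{μν}(x) = Σ_{s,t=0}^{L−1} F_{μν}(x + sμ̂ + tν̂)` is quantised,
  `φ_{μν} = 2π m_{μν}` with an anti-symmetric integer tensor `m` (§2.2 (2.10)–(2.11), Lemma 7.3), the admissible fields with
  given `m` form the flux sector `𝔘[m]`, and (§7.2, the displayed example after (7.5)) the field
  `V_{[m]}(x,μ) = exp{ −(2πi/L²) [ L δ_{x̃_μ, L−1} Σ_{ν>μ} m_{μν} x̃_ν + Σ_{ν<μ} m_{μν} x̃_ν ] }`, `x̃_μ = x_μ mod L`,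
  "is periodic and can be shown to have constant field tensor equal to `2π m_{μν}/L²`"; it lies in `𝔘[m]` whenever
  `|2π m_{μν}/L²| < ε` (§7.2, the bound before the example).
* [IgarashiOkuyamaSuzuki2002] H. Igarashi, K. Okuyama, H. Suzuki, *More about the axial anomaly on the lattice*,
  Nucl. Phys. B 644 (2002) 383 (arXiv:hep-lat/0206003), §2–§3: for the overlap Dirac operator `D` with mass parameter
  `|m| = 1` and admissible `U(1)` fields, `‖1 − U(x,μ,ν)‖ < ε`, `ε < (2−√2)/(d(d−1))` [Neuberger2000Bounds], the axial
  anomaly `𝒜(x) = tr γ_{d+1}[1 − ½D(x,x)]` satisfies the lattice index theorem `Σ_{x∈Γ} 𝒜(x) = n₊ − n₋`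
  ((2.3), [HasenfratzLalienaNiedermayer1998]) and THEOREM 3.1: if the lattice is sufficiently large compared to the
  localisation range `ϱ` of `D` ("say `L/ϱ ≥ n`"), `𝒜(x) = q(x) + ∂*_μ k_μ(x)` with a periodic current `k_μ`; consequently
  (eq. (3.4) and the footnote to it) the index is `Σ_x 𝒜(x) = (𝒩 (−1)^{d/2}/(2^{d/2}(d/2)!)) ε_{μ₁ν₁…} m_{μ₁ν₁}⋯m_{μ_{d/2}ν_{d/2}}`,
  i.e. in `d = 4`:  `n₊ − n₋ = 𝒩 · (m₀₁ m₂₃ − m₀₂ m₁₃ + m₀₃ m₁₂)`, where the integer `𝒩` "is given by a sum of chiral charges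
  of massless degrees of freedom" fixed by the classical continuum limit [Adams2002AxialAnomaly] — for ONE Wilson–overlap
  fermion with `0 < m₀ < 2`, `|𝒩| = 1`.  "For the overlap-Dirac operator this relation has been verified numerically for
  `d = 2` and `d = 4` [Fujiwara2002SpectralFlow] and proven analytically for `d = 2`."
* [Fujiwara2002SpectralFlow] T. Fujiwara, Prog. Theor. Phys. 107 (2002) 163 (arXiv:hep-lat/0012007), eq. (2.2):
  `index D = Tr γ_{d+1}(1 − ½D) = −½ Tr (H/√H²)` for `H = γ_{d+1}(D_W − m)|_{m=1}` — the index is the spectral asymmetry of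
  the (invertible) Hermitian Wilson–Dirac operator, `index D = N₋(H) − ½ dim`; §3: the flux-sector example fields above are the
  `t = m₀₁`, `s = m₂₃` members of his one-parameter families, for which `index D = (−1)^{d/2} Q_{d/2}`, `Q₂ = m₀₁ m₂₃` is found.

## How it is stated here

Lattice units; the tree's periodic torus `TorusSite 4 L = (ℤ/Lℤ)⁴` (`x̃_μ = (x μ).val`), compact `U(1) = Circle` link fields
`GaugeConfig 4 L Circle` read through the defining representation `u1Rep` (`GaugeGroups.lean`), and the tree's Wilson operator
`wilsonDirac u1Rep U m 1` (`GrassmannIntegral.lean`; `r = 1`; conventions = HJL App. A, see `OverlapLocality.lean`), so that the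
Hermitian Wilson–Dirac operator at the overlap point `m₀ = 1` is `spinorLift gammaFive * wilsonDirac u1Rep U (−1) 1`.

* `fluxSectorField L m` — Lüscher's example field `V_{[m]}` of the flux sector `m` (a DEFINITION, the displayed formula of §7.2).
* `IOSFluxSectorIndex` — ONE named fact (not proved here): the finite-volume index formula of [IgarashiOkuyamaSuzuki2002]
  Thm 3.1 + (2.3) + (3.4), read through [Fujiwara2002SpectralFlow] (2.2) as a statement about the NEGATIVE-EIGENVALUE COUNT of
  the Hermitian Wilson–Dirac operator of `V_{[m]}` at `m₀ = 1`: there are a universal sign `s ∈ {1, −1}` (the orientation /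
  `γ₅` convention behind `𝒩 = ±1`, deliberately not pinned here) and a size `L₁` (IOS's "sufficiently large compared to the
  localisation range", uniform here because the admissibility margin is fixed) such that for `L ≥ L₁` and every anti-symmetric
  integer tensor `m` with `2π |m_{μν}| ≤ L²/50` (so `V_{[m]}` is admissible with `‖1 − U(p)‖ ≤ 2π|m_{μν}|/L² ≤ 1/50`, inside both
  the IOS/Neuberger range `(2−√2)/12` and the HJL range `1/30` at `m₀ = 1`), the number of negative roots (with multiplicity) of
  the characteristic polynomial of `Γ₅ D_W(V_{[m]}, −1, 1)` equals `2L⁴ + s (m₀₁ m₂₃ − m₀₂ m₁₃ + m₀₃ m₁₂)` (`2L⁴ = ½ dim`).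
  The count is written with `Polynomial.roots`/`Multiset.countP` exactly as in the QCD statements of this tree.

Scope caveats. (i) The fact is the SPECIAL CASE of the IOS index formula for Lüscher's sector representatives `V_{[m]}` (the
general admissible field of the sector has the same index by Thm 3.1; not vendored).  `-- TODO(general form): every admissible
U(1) field U on Γ with flux tensor m and L ≥ L₁ has N₋(Γ₅ D_W(U,−1,1)) = 2L⁴ + s·Q₂(m).`  (ii) `|𝒩| = 1` for one overlap
fermion is the continuum-matching input [Adams2002AxialAnomaly]; the sign `s` absorbs the `γ₅`/orientation convention.
(iii) Nothing about other mass parameters `m₀ ≠ 1` is claimed (that transport is done by users via the HJL gap).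
(iv) The constant field tensor of `V_{[m]}` (Lüscher §7.2) is provable by direct computation and is left to users
(`-- TODO: plaquetteHolonomy (fluxSectorField L m) = Circle.exp (2π m μ ν / L²)` for `μ < ν`, `L ≥ 1`).

## References

* M. Lüscher, Nucl. Phys. B 549 (1999) 295–334, arXiv:hep-lat/9811032, §2.2, §7.2. [Luscher1999AbelianChiral]
* H. Igarashi, K. Okuyama, H. Suzuki, Nucl. Phys. B 644 (2002) 383–394, arXiv:hep-lat/0206003, (2.3), Thm 3.1, (3.4).
  [IgarashiOkuyamaSuzuki2002]
* T. Fujiwara, Prog. Theor. Phys. 107 (2002) 163–175, arXiv:hep-lat/0012007, (2.2), §3. [Fujiwara2002SpectralFlow]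
* P. Hasenfratz, V. Laliena, F. Niedermayer, Phys. Lett. B 427 (1998) 125, arXiv:hep-lat/9801021. [HasenfratzLalienaNiedermayer1998]
* H. Neuberger, Phys. Rev. D 61 (2000) 085015, arXiv:hep-lat/9911004. [Neuberger2000Bounds]
* D. H. Adams, Ann. Phys. 296 (2002) 131–151, arXiv:hep-lat/9812003. [Adams2002AxialAnomaly]
-/

noncomputable section

open Matrix Finset
open Literature.Probability.LatticeModels (TorusSite)
open Literature.MathematicalPhysics.QuantumFieldTheory

namespace Literature.MathematicalPhysics.QuantumLattice

/-! ### Lüscher's flux-sector representative `V_{[m]}` -/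

/-- The phase (in radians) of Lüscher's flux-sector field `V_{[m]}` on the link `(x, μ)` of the periodic lattice of side `L`:
`−(2π/L²) [ L δ_{x̃_μ, L−1} Σ_{ν>μ} m_{μν} x̃_ν + Σ_{ν<μ} m_{μν} x̃_ν ]`, `x̃_ν = (x ν).val ∈ {0,…,L−1}`
(Lüscher 1999, §7.2, the displayed example field of the sector `𝔘[m]`). [cite: Luscher1999AbelianChiral, §7.2 (the field V_[m])] -/
def fluxSectorPhase (L : ℕ) (m : Fin 4 → Fin 4 → ℤ) (x : TorusSite 4 L) (μ : Fin 4) : ℝ :=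
  -(2 * Real.pi / (L : ℝ) ^ 2) *
    ((L : ℝ) * (if (x μ).val = L - 1 then 1 else 0) * (∑ ν : Fin 4, if μ < ν then (m μ ν : ℝ) * ((x ν).val : ℝ) else 0) +
      ∑ ν : Fin 4, if ν < μ then (m μ ν : ℝ) * ((x ν).val : ℝ) else 0)

/-- **Lüscher's flux-sector field** `V_{[m]}(x, μ) = exp(i · fluxSectorPhase L m x μ) ∈ U(1)` on the periodic lattice of side
`L`, for an (anti-symmetric) integer flux tensor `m` — "this field is periodic and can be shown to have constant field tensor
equal to `2π m_{μν}/L²`", hence it is an admissible representative of the magnetic flux sector `𝔘[m]` when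
`2π|m_{μν}|/L² < ε` (Lüscher 1999, §7.2).  For `m = 0` it is the trivial field. [cite: Luscher1999AbelianChiral, §7.2 (the field V_[m])] -/
def fluxSectorField (L : ℕ) (m : Fin 4 → Fin 4 → ℤ) : GaugeConfig 4 L Circle :=
  fun e => Circle.exp (fluxSectorPhase L m e.1 e.2)

/-- The phase of `V_{[0]}` vanishes. [folklore] -/
theorem fluxSectorPhase_zero (L : ℕ) (x : TorusSite 4 L) (μ : Fin 4) :
    fluxSectorPhase L (0 : Fin 4 → Fin 4 → ℤ) x μ = 0 := by
  simp [fluxSectorPhase]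

/-- `V_{[0]} = 1`: the representative of the vacuum sector is the trivial field. [folklore] -/
theorem fluxSectorField_zero (L : ℕ) : fluxSectorField L (0 : Fin 4 → Fin 4 → ℤ) = 1 := by
  funext e
  simp [fluxSectorField, fluxSectorPhase_zero, Circle.exp_zero]

/-- The phase is odd in the flux tensor: `fluxSectorPhase L (−m) = −fluxSectorPhase L m`. [folklore] -/
theorem fluxSectorPhase_neg (L : ℕ) (m : Fin 4 → Fin 4 → ℤ) (x : TorusSite 4 L) (μ : Fin 4) :
    fluxSectorPhase L (-m) x μ = -fluxSectorPhase L m x μ := by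
  simp only [fluxSectorPhase, Pi.neg_apply, Int.cast_neg, neg_mul]
  have h1 : (∑ ν : Fin 4, if μ < ν then -((m μ ν : ℝ) * ((x ν).val : ℝ)) else 0) =
      -∑ ν : Fin 4, if μ < ν then (m μ ν : ℝ) * ((x ν).val : ℝ) else 0 := by
    rw [← Finset.sum_neg_distrib]
    refine Finset.sum_congr rfl fun ν _ => ?_
    split_ifs <;> simp
  have h2 : (∑ ν : Fin 4, if ν < μ then -((m μ ν : ℝ) * ((x ν).val : ℝ)) else 0) =
      -∑ ν : Fin 4, if ν < μ then (m μ ν : ℝ) * ((x ν).val : ℝ) else 0 := by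
    rw [← Finset.sum_neg_distrib]
    refine Finset.sum_congr rfl fun ν _ => ?_
    split_ifs <;> simp
  rw [h1, h2]
  ring

/-- `V_{[−m]} = V_{[m]}⁻¹` linkwise (the complex-conjugate field). [folklore] -/
theorem fluxSectorField_neg (L : ℕ) (m : Fin 4 → Fin 4 → ℤ) :
    fluxSectorField L (-m) = (fluxSectorField L m)⁻¹ := by
  funext e
  simp only [fluxSectorField, Pi.inv_apply, fluxSectorPhase_neg, Circle.exp_neg]

/-! ### The finite-volume abelian index formula (Igarashi–Okuyama–Suzuki 2002), as one named fact -/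

/-- **Finite-volume abelian index formula for Lüscher's flux-sector fields (Igarashi–Okuyama–Suzuki 2002, Thm 3.1 with
(2.3) and (3.4); index = spectral asymmetry of the Hermitian Wilson–Dirac operator, Fujiwara 2002 (2.2)).**
There are a universal sign `s ∈ {1, −1}` and a lattice size `L₁` such that for every `L ≥ L₁` and every anti-symmetric
integer flux tensor `m` with `2π |m_{μν}| ≤ L²/50` for all `μ, ν` (so that `V_{[m]}` is admissible with
`‖1 − U(p)‖ ≤ 1/50 < (2 − √2)/12`, the IOS/Neuberger range at mass parameter `1`), the Hermitian Wilson–Dirac operator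
`H = Γ₅ D_W(V_{[m]}, −1, 1)` of the unit-charge fermion on the periodic lattice `(ℤ/Lℤ)⁴` has exactly
`2L⁴ + s·(m₀₁m₂₃ − m₀₂m₁₃ + m₀₃m₁₂)` negative eigenvalues, counted with multiplicity as roots of its characteristic
polynomial (`2L⁴ = ½·dim`; `N₋(H) − 2L⁴ = −½ Tr(H/√H²) = index D = 𝒩·⅛ε_{μνρσ}m_{μν}m_{ρσ}`, `|𝒩| = 1` for one overlap
fermion [Adams2002AxialAnomaly]; `s` absorbs the `γ₅`/orientation convention).  Special case (sector representatives only)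
of the printed theorem, which covers every admissible field of the sector. [cite: IgarashiOkuyamaSuzuki2002, Thm 3.1 with eqs. (2.3), (3.4)] -/
def IOSFluxSectorIndex : Prop :=
  ∃ (s : ℤ) (L₁ : ℕ), (s = 1 ∨ s = -1) ∧
    ∀ (L : ℕ) [NeZero L], L₁ ≤ L → ∀ m : Fin 4 → Fin 4 → ℤ, (∀ μ ν, m ν μ = -m μ ν) →
      (∀ μ ν, 2 * Real.pi * |(m μ ν : ℝ)| ≤ (L : ℝ) ^ 2 / 50) →
      (((spinorLift gammaFive * wilsonDirac u1Rep (fluxSectorField L m) (-1) 1).charpoly.roots.countP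
            fun z : ℂ => z.re < 0 : ℕ) : ℤ) =
        2 * (L : ℤ) ^ 4 + s * (m 0 1 * m 2 3 - m 0 2 * m 1 3 + m 0 3 * m 1 2)

end Literature.MathematicalPhysics.QuantumLattice

end
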